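import Summits.BirchSwinnertonDyer.BirchSwinnertonDyer.Theorems.QuadraticBranchSignedControlEtaTransportSelmerAdicModel
import Summits.BirchSwinnertonDyer.BirchSwinnertonDyer.Theorems.QuadraticBranchSignedControlEtaTransportLocalModelChangeSelmer
import Summits.BirchSwinnertonDyer.BirchSwinnertonDyer.Theorems.QuadraticBranchSignedControlEtaTransportDecompositionOfFrames
import HarnessLib

/-!
# Route `QuadraticBranchSignedControl` (rung K8, cell `bsd-potss`), crux `EtaTransportSigned`
# (item stmt-BirchSwinnertonDyer-19115): frame (i-f) DISCHARGED — `Sel⁺(V/ℚ_∞)` of Kobayashi's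
# Def. 1.1 IS p17's plus Selmer group at Mathlib's `ℚ_[p]` — and the decomposition frame `hdec`
# from (A) ALONE

WHAT. (i) `signedSelmerInfty_one_eq_strictSignedSelmerInfty_padic` —
`Kobayashi2003.signedSelmerInfty V κ 1 = strictSignedSelmerInfty V κ ℚ_[p] 1`, UNCONDITIONAL: the
unique place `v₀` of `ℚ` above `p`, (i-f)₁ (`…SelmerAdicModel`, the adic model) and (i-f)₂
(`…LocalModelChangeSelmer`, the change of model `ℚ_{v₀} ≃ ℚ_[p]`). (ii) `etaDecomposition_of_frameA` —
the frame `hdec` of `etaTransportPlus_of_decomposition` (p418003) from the single remaining frame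
(A) = ctrl's piece (i-c) (the `F`-internal ↔ `ℚ`-internal comparison
`Kobayashi2003.signedSelmerInfty V' κF 1 ≃+ towerSignedSelmerInfty V κ F ℚ_[p] 1`, Γ-compatibly),
by `etaDecomposition_of_frames` with (i-f) discharged. So the crux stands at:
**`EtaTransportSigned` ⟸ (A) + the named fact `Kobayashi2003.thm74_etaEvenMC_iff_etaOddMC`**
(`etaTransportSigned_of_decomposition_of_thm74Fact`).

HONEST FRAMING (cell `bsd-potss`, run/shared/lean/pub/bsd-potss/; FULL-BSD rank ≤ 1 programme):
TOOL THEOREMS ONLY — no definition, no named Literature fact, no `sorry`, axioms standard.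
(i) is unconditional; (ii) is CONDITIONAL on the displayed frame (A) (WANTED). The item is NOT
closed; nothing is booked; `BSD(W, p)` is claimed for no pair; BSD is not proved by any of this.
Seat `bsd-potss-k8q-c3` (prover), g0.

References: [Kobayashi2003] Def. 1.1 (p. 2), Def. 2.1 (p. 5), §4 p. 8; [GreenbergLNM1716] §2–§3.
-/

set_option autoImplicit false
set_option linter.dupNamespace false

noncomputable section

open scoped Classical

open Field WeierstrassCurve NumberField IsDedekindDomain
open Literature.NumberTheory.EllipticCurves
open Literature.NumberTheory.GaloisRepresentations
open Summit.BirchSwinnertonDyer.Rank1Residual.Additive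

namespace Summit.BirchSwinnertonDyer.BirchSwinnertonDyer.Theorems

/-- **(i-f) `Kobayashi2003.signedSelmerInfty V κ 1 = strictSignedSelmerInfty V κ ℚ_[p] 1`**
(UNCONDITIONAL): there is a place `v₀` of `ℚ` above `p` (the maximal ideal `(p)` of `𝓞 ℚ`);
Kobayashi's Def. 1.1 plus Selmer group is p17's plus Selmer group at the adic model `ℚ_{v₀}`
(`signedSelmerInfty_one_eq_strictSignedSelmerInfty_adicCompletion`), and the latter does not change
under the model isomorphism `ℚ_{v₀} ≃ ℚ_[p]` (`strictSignedSelmerInfty_one_adicCompletion_eq_padic`).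
[cite: Kobayashi2003, Def. 1.1 (p. 2)] -/
theorem signedSelmerInfty_one_eq_strictSignedSelmerInfty_padic (V : WeierstrassCurve ℚ) {p : ℕ}
    [Fact p.Prime] (κ : ZpExtension ℚ p) :
    Kobayashi2003.signedSelmerInfty V κ 1 = strictSignedSelmerInfty V κ ℚ_[p] 1 := by
  have hpP : p.Prime := Fact.out
  obtain ⟨v₀, hv₀⟩ : ∃ v : HeightOneSpectrum (𝓞 ℚ), ((p : ℕ) : 𝓞 ℚ) ∈ v.asIdeal := by
    have hnu : ¬ IsUnit ((p : ℕ) : 𝓞 ℚ) := by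
      intro h
      have h' := h.map Rat.ringOfIntegersEquiv
      rw [map_natCast, Int.isUnit_iff_natAbs_eq, Int.natAbs_natCast] at h'
      exact hpP.one_lt.ne' h'
    obtain ⟨M, hM, hle⟩ := Ideal.exists_le_maximal (Ideal.span {((p : ℕ) : 𝓞 ℚ)})
      (by rwa [Ne, Ideal.span_singleton_eq_top])
    have hpM : ((p : ℕ) : 𝓞 ℚ) ∈ M := hle (Ideal.mem_span_singleton_self _)
    refine ⟨⟨M, hM.isPrime, fun hbot => ?_⟩, hpM⟩
    rw [hbot, Ideal.mem_bot] at hpM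
    exact hpP.ne_zero (by exact_mod_cast hpM)
  rw [signedSelmerInfty_one_eq_strictSignedSelmerInfty_adicCompletion V κ v₀ hv₀,
    strictSignedSelmerInfty_one_adicCompletion_eq_padic V κ v₀ hv₀]

/-- **The decomposition frame `hdec` of `etaTransportPlus_of_decomposition` from the frame (A)
ALONE** ((i-f) discharged by `signedSelmerInfty_one_eq_strictSignedSelmerInfty_padic`). Hence
`EtaTransportSigned` ⟸ (A) + `Kobayashi2003.thm74_etaEvenMC_iff_etaOddMC`
(`etaTransportSigned_of_decomposition_of_thm74Fact (etaDecomposition_of_frameA hA) h74`).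
CONDITIONAL on the displayed frame `hA` (ctrl's (i-c); WANTED). [cite: Kobayashi2003, §4 p. 8, Def. 1.1 (p. 2), Def. 2.1 (p. 5)]
[cite: GreenbergLNM1716, §3] -/
theorem etaDecomposition_of_frameA
    (hA : ∀ (p : ℕ) [Fact p.Prime], 5 ≤ p →
      ∀ (K₀ : Type) [Field K₀] [NumberField K₀] [IsCyclotomicExtension {p} ℚ K₀]
        [(galRange (K := ℚ) K₀).Normal] (ηq : absoluteGaloisGroup ℚ →* ℤˣ),
        (∀ σ ∈ galRange (K := ℚ) K₀, ηq σ = 1) → ηq ≠ 1 →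
      ∀ (V : WeierstrassCurve ℚ) [V.IsElliptic] [V.IsGloballyMinimal],
        V.HasGoodReductionAtPrime p → V.frobeniusTrace p = 0 →
      ∀ (κ : ZpExtension ℚ p) (γ : absoluteGaloisGroup ℚ),
        κ.IsCyclotomic → κ.IsTopGenerator γ → γ ∈ galRange (K := ℚ) K₀ →
        IsCyclotomicVariable p γ →
      ∃ (F : Type) (_ : Field F) (_ : NumberField F) (_ : (galRange (K := ℚ) F).Normal) (θF : F)
        (V' : WeierstrassCurve F) (_ : V'.IsElliptic) (κF : ZpExtension F p)
        (γF : absoluteGaloisGroup F)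
        (ΨA : Kobayashi2003.signedSelmerInfty V' κF 1 ≃+ towerSignedSelmerInfty V κ F ℚ_[p] 1),
        Module.finrank ℚ F = 2 ∧ θF ∉ Set.range (algebraMap ℚ F) ∧
        θF ^ 2 = algebraMap ℚ F ((-1) ^ (p / 2) * p) ∧
        (∃ C : VariableChange F, C • V.baseChange F = V') ∧
        κF.IsCyclotomic ∧ κF.IsTopGenerator γF ∧
        (∃ ζ : ℤ_[p]ˣ, IsOfFinOrder ζ ∧
          ((GaloisRep.cyclotomicCharacter F p γF * ζ : ℤ_[p]ˣ) : ℤ_[p]) =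
            (cyclotomicGenerator p : ℤ_[p])) ∧
        γ⁻¹ * resGal (K := ℚ) F γF ∈ κ.kerSubgroup ∧
        ∀ s : Kobayashi2003.signedSelmerInfty V' κF 1,
          ((ΨA ⟨V'.conjH1 p κF.kerSubgroup γF s,
              Kobayashi2003.conjH1_mem_signedSelmerInfty V' κF 1 γF s.2⟩ :
              towerSignedSelmerInfty V κ F ℚ_[p] 1) : V.subgroupH1 p (towerTopSubgroup κ F)) =
            V.conjH1 p (towerTopSubgroup κ F) (resGal (K := ℚ) F γF) (ΨA s)) :
    ∀ (p : ℕ) [Fact p.Prime], 5 ≤ p →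
      ∀ (K₀ : Type) [Field K₀] [NumberField K₀] [IsCyclotomicExtension {p} ℚ K₀]
        [(galRange (K := ℚ) K₀).Normal] (ηq : absoluteGaloisGroup ℚ →* ℤˣ),
        (∀ σ ∈ galRange (K := ℚ) K₀, ηq σ = 1) → ηq ≠ 1 →
      ∀ (V : WeierstrassCurve ℚ) [V.IsElliptic] [V.IsGloballyMinimal],
        V.HasGoodReductionAtPrime p → V.frobeniusTrace p = 0 →
      ∀ (κ : ZpExtension ℚ p) (γ : absoluteGaloisGroup ℚ),
        κ.IsCyclotomic → κ.IsTopGenerator γ → γ ∈ galRange (K := ℚ) K₀ →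
        IsCyclotomicVariable p γ →
      ∃ (F : Type) (_ : Field F) (_ : NumberField F) (V' : WeierstrassCurve F) (_ : V'.IsElliptic)
        (κF : ZpExtension F p) (γF : absoluteGaloisGroup F)
        (Φ : Kobayashi2003.signedSelmerInfty V' κF 1 ≃+
          Kobayashi2003.signedSelmerInfty V κ 1 × towerSignedSelmerInftyEta V κ K₀ ℚ_[p] ηq 1),
        Module.finrank ℚ F = 2 ∧ (∃ θ : F, θ ^ 2 = algebraMap ℚ F ((-1) ^ (p / 2) * p)) ∧
        (∃ C : VariableChange F, C • V.baseChange F = V') ∧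
        κF.IsCyclotomic ∧ κF.IsTopGenerator γF ∧
        (∃ ζ : ℤ_[p]ˣ, IsOfFinOrder ζ ∧
          ((GaloisRep.cyclotomicCharacter F p γF * ζ : ℤ_[p]ˣ) : ℤ_[p]) =
            (cyclotomicGenerator p : ℤ_[p])) ∧
        ∀ s : Kobayashi2003.signedSelmerInfty V' κF 1,
          ((Φ ⟨V'.conjH1 p κF.kerSubgroup γF s,
              Kobayashi2003.conjH1_mem_signedSelmerInfty V' κF 1 γF s.2⟩).1 :
              V.subgroupH1 p κ.kerSubgroup) =
            V.conjH1 p κ.kerSubgroup γ (Φ s).1 ∧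
          ((Φ ⟨V'.conjH1 p κF.kerSubgroup γF s,
              Kobayashi2003.conjH1_mem_signedSelmerInfty V' κF 1 γF s.2⟩).2 :
              V.subgroupH1 p (towerTopSubgroup κ K₀)) =
            V.conjH1 p (towerTopSubgroup κ K₀) γ (Φ s).2 :=
  etaDecomposition_of_frames hA fun _ _ _ V _ _ _ _ κ _ =>
    signedSelmerInfty_one_eq_strictSignedSelmerInfty_padic V κ

end Summit.BirchSwinnertonDyer.BirchSwinnertonDyer.Theorems

end
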